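import Literature.Barriers.CriticalPhenomena.WeaklySAWFlowWeightedSpaces
import HarnessLib

/-!
# [BBS-rg-flow, Lemma 4.3 as printed]: `S̄ = diag(1, S̄_{𝒱𝒱}) : X^𝗏 → X^𝗐` as a bounded solution
# operator on `ℓ^∞(∏𝒲_j) × ℓ^∞(ℝ³)`, in the source convention of the paper

Ninth file of the series formalising [BBS-rg-flow] (Bauerschmidt–Brydges–Slade, AHP 16 (2015),
arXiv:1211.2477), the abstract dynamical-system input of BBS 2015, Theorem 4.1 (via its Theorem 7.2.1),
towards `Literature.Barriers.CriticalPhenomena.WeaklySAWFourDimLogCorrections`; continuation of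
`WeaklySAWFlowWeightedSpaces.lean` (`SeqV`, the weights (3.2), `sbarVCLM`).

§3.2–§3.3 of the source place all sequences in the SAME product `∏_j X_j`, `X_j = 𝒲_j ⊕ ℝ³`
((3.1)), with maps inserted as `(φ(x))₀ = 0`, `(φ(x))_{j+1} = φ_j(x_j)` ((3.8)); accordingly the
linear equation solved by `S̄` reads `y_{j+1} = L_jy_j + r_{j+1}` with the source at POSITION `j+1`,
measured with the weight `𝗏_{α,j+1}`. This file
* introduces `SeqK 𝒲 = ℓ^∞(∏_j 𝒲_j)` for a scale-dependent family of Banach spaces `𝒲_j`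
  (Mathlib's `lp 𝒲 ∞`), the `𝒦`-part of `X^𝗐 ≅ X^𝗏` in scaled coordinates;
* proves the one-step weight ratios `χ_jg̊_j³ ≤ Ω(1-2Bg₀)⁻³χ_{j+1}g̊_{j+1}³` ("`ḡ_j³/ḡ_{j+1}³ = 1+O(g₀)`",
  proof of Lemma 1.3; this is the factor in `‖D_Kψ‖_{L(X^𝗐,X^𝗏)} ≤ κΩ(1+O(g₀))`, (3.10)) and
  `χ_{j+1}g̊_{j+1}³ ≤ (27/8)χ_jg̊_j³`;
* relates the landed `sbarVCLM` (sources indexed by the step) to the paper's convention through the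
  bounded shift-rescale `T`, `(Tr̃)_l = (𝗏_{l+1}/𝗏_l)r̃_{l+1}`, `‖T‖ ≤ 27/8` (`shiftVCLM`), sets
  `S̄_{𝒱𝒱} := sbarVCLM ∘ T` (`sbarVP`, `‖S̄_{𝒱𝒱}‖ ≤ (27/8)C_S̄`) and PROVES that `y = 𝗐·S̄_{𝒱𝒱}r̃`
  solves `y_{j+1} = L_jy_j + 𝗏_{j+1}r̃_{j+1}`, `g₀ = 0`, `(z, μ)_∞ = 0` (`sbarVP_solves`);
* defines `S̄ = diag(1, S̄_{𝒱𝒱})` on `SeqK 𝒲 × SeqV` (`sbarCLM`; the `𝒦`-row `K_j = r_{K,j}` is the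
  identity because `𝗐_K = 𝗏_K`, (4.13)) with `‖S̄‖ ≤ max(1, (27/8)C_S̄)` (`norm_sbarCLM_le`), a constant
  depending only on `(Ω, c, N, C, λ)` as printed in (4.12).

Deliberately NOT here: Assumption (A3) and Lemma 3.3, Lemmas 4.4–4.5, Lemma 3.5.

## References
* R. Bauerschmidt, D. C. Brydges, G. Slade, *Structural stability of a dynamical system near a
  non-hyperbolic fixed point*, Ann. Henri Poincaré 16 (2015), arXiv:1211.2477: §3.2 (3.1)–(3.2), (3.8),
  Lemma 1.3 (proof), Lemma 4.2 (4.10)–(4.11), Lemma 4.3 (4.12)–(4.13). [BauerschmidtBrydgesSlade2015Flow]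
-/

noncomputable section

open Filter Topology Set
open scoped BigOperators ENNReal

namespace Literature.Barriers.CriticalPhenomena

namespace CTWSAW

/-! ## The `𝒦`-part: sequence spaces over the scale-dependent Banach spaces `𝒲_j`, the weight
ratio `𝗐_{K,j}/𝗏_{K,j+1} ≤ Ω(1 + O(g₀))` (the operator norm of `D_Kψ` in scaled coordinates, Lemma 3.3) -/

open scoped ENNReal

/-- `ℓ^∞(∏_j 𝒲_j)`: bounded sequences `(K_j)_j`, `K_j ∈ 𝒲_j` — the `𝒦`-part of both `X^𝗐` and `X^𝗏`
in scaled coordinates (the two spaces are the same product `∏_j X_j` with different weights).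
[cite: BauerschmidtBrydgesSlade2015Flow, §3.2, (3.1) and Remark 3.2] -/
abbrev SeqK (W : ℕ → Type*) [∀ j, NormedAddCommGroup (W j)] : Type _ := ↥(lp W ∞)

namespace CutoffGbarHyp

variable {β : ℕ → ℝ} {Ω : ℝ} {k : ℕ∞} {B c : ℝ} {N : ℕ} {g₀ : ℝ} (h : CutoffGbarHyp β Ω k B c N g₀)
include h

/-- `1 - 2Bg₀ ≥ 1/2 > 0`. [cite: BauerschmidtBrydgesSlade2015Flow, Lemma 2.1(i)] -/
theorem half_le_one_sub_two_mul : 1 / 2 ≤ 1 - 2 * B * g₀ := by linarith [h.smallB]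

/-- `ḡ_j ≤ (1 - 2Bg₀)⁻¹ḡ_{j+1}`: one step of the flow costs at most a factor `1 + O(g₀)`
("`ḡ_j³/ḡ_{j+1}³ = 1 + O(g₀)`", proof of Lemma 1.3). [cite: BauerschmidtBrydgesSlade2015Flow, Lemma 1.3 (proof) and Lemma 2.1(i)] -/
theorem gbar_le_mul_succ (j : ℕ) : gbar β g₀ j ≤ (1 - 2 * B * g₀)⁻¹ * gbar β g₀ (j + 1) := by
  have hq := h.half_le_one_sub_two_mul
  have hg := h.gbar_pos j
  have hb : β j * gbar β g₀ j ≤ 2 * B * g₀ := by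
    have := h.abs_beta_mul_gbar_le j
    have hw : 2 * B * g₀ * cutoffWeight Ω k j ≤ 2 * B * g₀ := by
      have h1 := h.weight_le_one j; have := h.B_nonneg; have := h.g₀_pos
      exact mul_le_of_le_one_right (by positivity) h1
    calc β j * gbar β g₀ j ≤ |β j| * gbar β g₀ j := by gcongr; exact le_abs_self _
      _ ≤ 2 * B * g₀ := this.trans hw
  rw [gbar_succ' β g₀ j, le_inv_mul_iff₀ (by linarith)]
  calc (1 - 2 * B * g₀) * gbar β g₀ j = gbar β g₀ j * (1 - 2 * B * g₀) := mul_comm _ _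
    _ ≤ gbar β g₀ j * (1 - β j * gbar β g₀ j) := by gcongr

/-- The weight ratio of one step: `χ_jḡ_j³ ≤ Ω(1 - 2Bg₀)⁻³ · χ_{j+1}ḡ_{j+1}³`, i.e.
`𝗐_{K,j}/𝗐_{K,j+1} = 𝗏_{α,j}/𝗏_{α,j+1} ≤ Ω(1 + O(g₀))` (used in Lemma 1.3 and in the `𝒦`-rows of
Lemmas 3.3 and 4.3). [cite: BauerschmidtBrydgesSlade2015Flow, Lemma 1.3 (proof) and §3.2, (3.2)] -/
theorem weight_cube_le_mul_succ (j : ℕ) :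
    cutoffWeight Ω k j * gbar β g₀ j ^ 3 ≤
      Ω * ((1 - 2 * B * g₀)⁻¹) ^ 3 * (cutoffWeight Ω k (j + 1) * gbar β g₀ (j + 1) ^ 3) := by
  have hq := h.half_le_one_sub_two_mul
  have hw := cutoffWeight_le_mul_succ h.one_le k j
  have hg := h.gbar_le_mul_succ j
  have h0 := (h.gbar_pos j).le; have h1 := (h.gbar_pos (j + 1)).le; have := (h.weight_pos (j + 1)).le
  have hΩ : 0 ≤ Ω := by linarith [h.one_lt]
  have hi : 0 ≤ (1 - 2 * B * g₀)⁻¹ := inv_nonneg.2 (by linarith)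
  calc cutoffWeight Ω k j * gbar β g₀ j ^ 3
      ≤ (Ω * cutoffWeight Ω k (j + 1)) * ((1 - 2 * B * g₀)⁻¹ * gbar β g₀ (j + 1)) ^ 3 := by
        gcongr
    _ = _ := by ring

end CutoffGbarHyp


/-! ## The shift-rescale `T` relating the landed `sbarV` (sources indexed by the step `l`) to the
source convention of the paper (`y_{j+1} = L_jy_j + r_{j+1}`, sources at POSITION `j+1` with weight
`𝗏_{α,j+1}`): `(T r̃)_l = (𝗏_{V,l+1}/𝗏_{V,l}) r̃_{l+1}`, ratio `χ_{l+1}g̊_{l+1}³/(χ_lg̊_l³) ≤ 27/8`. -/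

namespace CutoffGbarHyp

variable {β : ℕ → ℝ} {Ω : ℝ} {k : ℕ∞} {B c : ℝ} {N : ℕ} {g₀ : ℝ} (h : CutoffGbarHyp β Ω k B c N g₀)
include h

/-- `χ_{l+1}ḡ_{l+1}³ ≤ (27/8)χ_lḡ_l³` (`χ` non-increasing, `ḡ_{l+1} ≤ (3/2)ḡ_l`).
[cite: BauerschmidtBrydgesSlade2015Flow, Lemma 2.1(i), (2.8) and §1.3, (1.8)] -/
theorem weight_cube_succ_le (l : ℕ) :
    cutoffWeight Ω k (l + 1) * gbar β g₀ (l + 1) ^ 3 ≤ 27 / 8 * (cutoffWeight Ω k l * gbar β g₀ l ^ 3) := by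
  have hw := cutoffWeight_succ_le h.one_le k l
  have hg := (h.gbar_succ_mem l).2
  have h0 := (h.gbar_pos (l + 1)).le; have h1 := (h.gbar_pos l).le; have := (h.weight_pos l).le
  have := (h.weight_pos (l + 1)).le
  calc cutoffWeight Ω k (l + 1) * gbar β g₀ (l + 1) ^ 3 ≤ cutoffWeight Ω k l * (3 / 2 * gbar β g₀ l) ^ 3 := by gcongr
    _ = _ := by ring

/-- The shift-rescale ratio `χ_{l+1}ḡ_{l+1}³/(χ_lḡ_l³) ∈ [0, 27/8]`. [cite: BauerschmidtBrydgesSlade2015Flow, Lemma 2.1(i)] -/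
theorem shift_ratio_mem (l : ℕ) :
    cutoffWeight Ω k (l + 1) * gbar β g₀ (l + 1) ^ 3 / (cutoffWeight Ω k l * gbar β g₀ l ^ 3) ∈ Set.Icc (0 : ℝ) (27 / 8) := by
  have hpos : 0 < cutoffWeight Ω k l * gbar β g₀ l ^ 3 := mul_pos (h.weight_pos _) (pow_pos (h.gbar_pos _) 3)
  refine ⟨div_nonneg (mul_nonneg (h.weight_pos _).le (pow_nonneg (h.gbar_pos _).le 3)) hpos.le, ?_⟩
  rw [div_le_iff₀ hpos]; exact h.weight_cube_succ_le l

end CutoffGbarHyp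

/-- The shift-rescale `(T r̃)_l = (χ_{l+1}g̊_{l+1}³/(χ_lg̊_l³)) r̃_{l+1}` on `ℝ³`-valued sequences.
[cite: BauerschmidtBrydgesSlade2015Flow, §3.2, (3.8) and Lemma 4.3] -/
def shiftV (β : ℕ → ℝ) (g₀ Ω : ℝ) (k : ℕ∞) (r : ℕ → V3) (l : ℕ) : V3 :=
  (cutoffWeight Ω k (l + 1) * gbar β g₀ (l + 1) ^ 3 / (cutoffWeight Ω k l * gbar β g₀ l ^ 3)) • r (l + 1)

/-- Unfolding. [cite: BauerschmidtBrydgesSlade2015Flow, §3.2, (3.8)] -/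
theorem shiftV_apply (β : ℕ → ℝ) (g₀ Ω : ℝ) (k : ℕ∞) (r : ℕ → V3) (l : ℕ) :
    shiftV β g₀ Ω k r l =
      (cutoffWeight Ω k (l + 1) * gbar β g₀ (l + 1) ^ 3 / (cutoffWeight Ω k l * gbar β g₀ l ^ 3)) • r (l + 1) := rfl

namespace CutoffGbarHyp

variable {β : ℕ → ℝ} {Ω : ℝ} {k : ℕ∞} {B c : ℝ} {N : ℕ} {g₀ : ℝ} (h : CutoffGbarHyp β Ω k B c N g₀)
include h

/-- `‖(T r̃)_l‖ ≤ (27/8) sup ‖r̃‖`. [cite: BauerschmidtBrydgesSlade2015Flow, Lemma 2.1(i)] -/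
theorem norm_shiftV_apply_le {r : ℕ → V3} {M : ℝ} (hr : ∀ l, ‖r l‖ ≤ M) (l : ℕ) :
    ‖shiftV β g₀ Ω k r l‖ ≤ 27 / 8 * M := by
  obtain ⟨h0, h1⟩ := h.shift_ratio_mem l
  rw [shiftV_apply, norm_smul, Real.norm_eq_abs, abs_of_nonneg h0]
  exact mul_le_mul h1 (hr _) (norm_nonneg _) (by norm_num)

/-- The shift-rescale as a linear map on `ℓ^∞(ℕ; ℝ³)`. [cite: BauerschmidtBrydgesSlade2015Flow, §3.2, (3.8)] -/
def shiftVLin : SeqV →ₗ[ℝ] SeqV where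
  toFun r := ⟨shiftV β g₀ Ω k r, memℓp_infty ⟨27 / 8 * ‖r‖, by
    rintro _ ⟨l, rfl⟩
    exact h.norm_shiftV_apply_le (fun l => lp.norm_apply_le_norm ENNReal.top_ne_zero r l) l⟩⟩
  map_add' r r' := by ext l : 2; simp only [lp.coeFn_add, Pi.add_apply, shiftV_apply, smul_add]
  map_smul' a r := by
    ext l : 2; simp only [lp.coeFn_smul, Pi.smul_apply, shiftV_apply, RingHom.id_apply, smul_comm a]

/-- The shift-rescale as a bounded operator on `ℓ^∞(ℕ; ℝ³)`, `‖T‖ ≤ 27/8`.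
[cite: BauerschmidtBrydgesSlade2015Flow, §3.2, (3.8)] -/
def shiftVCLM : SeqV →L[ℝ] SeqV :=
  h.shiftVLin.mkContinuous (27 / 8) fun r => lp.norm_le_of_forall_le (by positivity) fun l =>
    h.norm_shiftV_apply_le (fun l => lp.norm_apply_le_norm ENNReal.top_ne_zero r l) l

/-- Unfolding. [cite: BauerschmidtBrydgesSlade2015Flow, §3.2, (3.8)] -/
theorem shiftVCLM_apply (r : SeqV) (l : ℕ) : (h.shiftVCLM r : ℕ → V3) l = shiftV β g₀ Ω k r l := rfl

/-- `‖T‖ ≤ 27/8`. [cite: BauerschmidtBrydgesSlade2015Flow, §3.2, (3.8)] -/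
theorem norm_shiftVCLM_le : ‖h.shiftVCLM‖ ≤ 27 / 8 :=
  LinearMap.mkContinuous_norm_le _ (by norm_num) _

end CutoffGbarHyp


/-! ## `S̄ = diag(1, S̄_{𝒱𝒱}) : X^𝗏 → X^𝗐` in the source convention of the paper
(`y_{j+1} = L_jy_j + r_{j+1}`), as a bounded operator on `SeqK 𝒲 × SeqV` -/

namespace CutoffQuadHyp

variable {P : QuadFlowParams} {Ω : ℝ} {k : ℕ∞} {B c : ℝ} {N : ℕ} {C lam g₀ : ℝ}
  (h : CutoffQuadHyp P Ω k B c N C lam g₀)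
include h

/-- `S̄_{𝒱𝒱}` in the paper's source convention (sources at position `j+1`, weight `𝗏_{α,j+1}`):
the landed `sbarVCLM` composed with the shift-rescale `T`. [cite: BauerschmidtBrydgesSlade2015Flow, Lemma 4.3, (4.12)–(4.13)] -/
def sbarVP (hsmall : 4 * g₀ ≤ Real.exp (-1)) {hh : ℝ} (hh0 : 0 < hh) : SeqV →L[ℝ] SeqV :=
  (h.sbarVCLM hsmall hh0).comp h.toCutoffGbarHyp.shiftVCLM

/-- `‖S̄_{𝒱𝒱}‖ ≤ (27/8)C_S̄`. [cite: BauerschmidtBrydgesSlade2015Flow, Lemma 4.3, (4.12)] -/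
theorem norm_sbarVP_le (hsmall : 4 * g₀ ≤ Real.exp (-1)) {hh : ℝ} (hh0 : 0 < hh) :
    ‖h.sbarVP hsmall hh0‖ ≤ sbarConst Ω c N C lam * (27 / 8) :=
  (ContinuousLinearMap.opNorm_comp_le _ _).trans
    (mul_le_mul (h.norm_sbarVCLM_le hsmall hh0) h.toCutoffGbarHyp.norm_shiftVCLM_le (norm_nonneg _)
      h.sbarConst_nonneg)

/-- Unfolding: `S̄_{𝒱𝒱}r̃ = sbarV (T r̃)`. [cite: BauerschmidtBrydgesSlade2015Flow, Lemma 4.3, (4.13)] -/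
theorem sbarVP_apply (hsmall : 4 * g₀ ≤ Real.exp (-1)) {hh : ℝ} (hh0 : 0 < hh) (r : SeqV) (j : ℕ) :
    (h.sbarVP hsmall hh0 r : ℕ → V3) j = P.sbarV g₀ Ω k hh (shiftV P.β g₀ Ω k r) j := rfl

/-- The fed source is the paper's: `𝗏_{V,l}(T r̃)_l = 𝗏_{V,l+1} r̃_{l+1}`. [cite: BauerschmidtBrydgesSlade2015Flow, §3.2, (3.2) and (3.8)] -/
theorem vV_mul_shiftV {hh : ℝ} (r : ℕ → V3) (l : ℕ) (i : Fin 3) :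
    P.vV g₀ Ω k hh l * shiftV P.β g₀ Ω k r l i = P.vV g₀ Ω k hh (l + 1) * r (l + 1) i := by
  have hw : cutoffWeight Ω k l ≠ 0 := (h.weight_pos _).ne'
  have hg : gbar P.β g₀ l ≠ 0 := (h.gbar_pos _).ne'
  rw [shiftV_apply, Pi.smul_apply, smul_eq_mul, QuadFlowParams.vV, QuadFlowParams.vV, div_eq_mul_inv]
  field_simp

/-- **[BBS-rg-flow, Lemmas 4.2–4.3: `S̄` is the solution operator]** in the paper's convention: for a
scaled source `r̃ ∈ ℓ^∞`, the physical sequence `y = 𝗐·(S̄_{𝒱𝒱}r̃)`, i.e. `g_j = 𝗐_{g,j}ỹ_{g,j}`,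
`z_j = 𝗐_{z,j}ỹ_{z,j}`, `μ_j = 𝗐_{μ,j}ỹ_{μ,j}`, solves `y_{j+1} = L_jy_j + r_{j+1}` with the physical
source `r_{α,j+1} = 𝗏_{α,j+1}r̃_{α,j+1}`, the initial condition `g₀ = 0` and the final conditions
`(z_∞, μ_∞) = (0, 0)`. [cite: BauerschmidtBrydgesSlade2015Flow, Lemma 4.2, (4.10)–(4.11), and Lemma 4.3] -/
theorem sbarVP_solves (hsmall : 4 * g₀ ≤ Real.exp (-1)) {hh : ℝ} (hh0 : 0 < hh) (r : SeqV) :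
    (P.wG g₀ hh 0 * (h.sbarVP hsmall hh0 r : ℕ → V3) 0 0 = 0 ∧
      (∀ j, P.wG g₀ hh (j + 1) * (h.sbarVP hsmall hh0 r : ℕ → V3) (j + 1) 0 =
        P.aCoef g₀ j * (P.wG g₀ hh j * (h.sbarVP hsmall hh0 r : ℕ → V3) j 0) +
          P.vV g₀ Ω k hh (j + 1) * r (j + 1) 0) ∧
      (∀ j, P.wZ g₀ Ω k hh (j + 1) * (h.sbarVP hsmall hh0 r : ℕ → V3) (j + 1) 1 =
        -P.xiT g₀ j * (P.wG g₀ hh j * (h.sbarVP hsmall hh0 r : ℕ → V3) j 0) +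
          P.czCoef g₀ j * (P.wZ g₀ Ω k hh j * (h.sbarVP hsmall hh0 r : ℕ → V3) j 1) +
          P.vV g₀ Ω k hh (j + 1) * r (j + 1) 1) ∧
      (∀ j, P.wZ g₀ Ω k hh (j + 1) * (h.sbarVP hsmall hh0 r : ℕ → V3) (j + 1) 2 =
        P.etaT g₀ j * (P.wG g₀ hh j * (h.sbarVP hsmall hh0 r : ℕ → V3) j 0) +
          P.gammaT g₀ j * (P.wZ g₀ Ω k hh j * (h.sbarVP hsmall hh0 r : ℕ → V3) j 1) +
          P.lamT g₀ j * (P.wZ g₀ Ω k hh j * (h.sbarVP hsmall hh0 r : ℕ → V3) j 2) +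
          P.vV g₀ Ω k hh (j + 1) * r (j + 1) 2)) ∧
    Tendsto (fun j => P.wZ g₀ Ω k hh j * (h.sbarVP hsmall hh0 r : ℕ → V3) j 1) atTop (𝓝 0) ∧
    Tendsto (fun j => P.wZ g₀ Ω k hh j * (h.sbarVP hsmall hh0 r : ℕ → V3) j 2) atTop (𝓝 0) := by
  -- the fed sources are the paper's sources
  set s : ℕ → V3 := shiftV P.β g₀ Ω k r with hs
  -- bounds on the fed sources (any bound will do for the recursions)
  have hR : 0 ≤ hh * (27 / 8 * ‖r‖) := by positivity
  have hsb : ∀ l i, |s l i| ≤ 27 / 8 * ‖r‖ := fun l i =>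
    ((Real.norm_eq_abs _).symm.le.trans (norm_le_pi_norm (s l) i)).trans
      (h.toCutoffGbarHyp.norm_shiftV_apply_le (fun l => lp.norm_apply_le_norm ENNReal.top_ne_zero r l) l)
  have hb := fun i => h.abs_vV_mul_le hh0 hsb i
  obtain ⟨⟨h0, hg, hz, hμ⟩, ⟨tz, tμ⟩, -⟩ := h.linSol_spec hsmall hR (hb 0) (hb 1) (hb 2)
  have hwG : ∀ j, P.wG g₀ hh j ≠ 0 := fun j => (h.wG_pos hh0 j).ne'
  have hwZ : ∀ j, P.wZ g₀ Ω k hh j ≠ 0 := fun j => (h.wZ_pos hh0 j).ne'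
  -- unfold the scaled coordinates
  have eg : ∀ j, P.wG g₀ hh j * (h.sbarVP hsmall hh0 r : ℕ → V3) j 0 =
      P.linG g₀ (fun l => P.vV g₀ Ω k hh l * s l 0) j := fun j => by
    rw [sbarVP_apply, P.sbarV_apply_zero, mul_div_cancel₀ _ (hwG j)]
  have ez : ∀ j, P.wZ g₀ Ω k hh j * (h.sbarVP hsmall hh0 r : ℕ → V3) j 1 =
      P.linZ g₀ (fun l => P.vV g₀ Ω k hh l * s l 0) (fun l => P.vV g₀ Ω k hh l * s l 1) j := fun j => by
    rw [sbarVP_apply, P.sbarV_apply_one, mul_div_cancel₀ _ (hwZ j)]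
  have eμ : ∀ j, P.wZ g₀ Ω k hh j * (h.sbarVP hsmall hh0 r : ℕ → V3) j 2 =
      P.linMu g₀ (fun l => P.vV g₀ Ω k hh l * s l 0) (fun l => P.vV g₀ Ω k hh l * s l 1)
        (fun l => P.vV g₀ Ω k hh l * s l 2) j := fun j => by
    rw [sbarVP_apply, P.sbarV_apply_two, mul_div_cancel₀ _ (hwZ j)]
  refine ⟨⟨by rw [eg, h0], fun j => ?_, fun j => ?_, fun j => ?_⟩, ?_, ?_⟩
  · rw [eg, eg, hg j, h.vV_mul_shiftV r j 0]
  · rw [ez, ez, eg, hz j, h.vV_mul_shiftV r j 1]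
  · rw [eμ, eμ, eg, ez, hμ j, h.vV_mul_shiftV r j 2]
  · simpa only [ez] using tz
  · simpa only [eμ] using tμ

section Full

variable {W : ℕ → Type*} [∀ j, NormedAddCommGroup (W j)] [∀ j, NormedSpace ℝ (W j)]

/-- **[BBS-rg-flow, Lemma 4.3]**: `S̄ = diag(1, S̄_{𝒱𝒱}) : X^𝗏 → X^𝗐` on `SeqK 𝒲 × SeqV` (scaled
coordinates; the `𝒦`-row `K_j = r_{K,j}` is the identity since `𝗐_K = 𝗏_K`).
[cite: BauerschmidtBrydgesSlade2015Flow, Lemma 4.3, (4.12)–(4.13)] -/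
def sbarCLM (hsmall : 4 * g₀ ≤ Real.exp (-1)) {hh : ℝ} (hh0 : 0 < hh) :
    (SeqK W × SeqV) →L[ℝ] (SeqK W × SeqV) :=
  (ContinuousLinearMap.id ℝ (SeqK W)).prodMap (h.sbarVP hsmall hh0)

/-- Unfolding. [cite: BauerschmidtBrydgesSlade2015Flow, Lemma 4.3, (4.13)] -/
@[simp] theorem sbarCLM_apply (hsmall : 4 * g₀ ≤ Real.exp (-1)) {hh : ℝ} (hh0 : 0 < hh) (x : SeqK W × SeqV) :
    h.sbarCLM hsmall hh0 x = (x.1, h.sbarVP hsmall hh0 x.2) := rfl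

/-- **[BBS-rg-flow, Lemma 4.3, (4.12)]**: `‖S̄‖_{L(X^𝗏, X^𝗐)} ≤ C_S̄' = max(1, (27/8)C_S̄)`, independent of
`a`, `𝗁`, the cut-off and `g₀`. [cite: BauerschmidtBrydgesSlade2015Flow, Lemma 4.3, (4.12)] -/
theorem norm_sbarCLM_le (hsmall : 4 * g₀ ≤ Real.exp (-1)) {hh : ℝ} (hh0 : 0 < hh) :
    ‖(h.sbarCLM hsmall hh0 : (SeqK W × SeqV) →L[ℝ] (SeqK W × SeqV))‖ ≤
      max 1 (sbarConst Ω c N C lam * (27 / 8)) := by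
  refine ContinuousLinearMap.opNorm_le_bound _ (by positivity) fun x => ?_
  rw [sbarCLM_apply, Prod.norm_def, Prod.norm_def]
  refine max_le ?_ ?_
  · calc ‖x.1‖ ≤ 1 * max ‖x.1‖ ‖x.2‖ := by rw [one_mul]; exact le_max_left _ _
      _ ≤ _ := mul_le_mul_of_nonneg_right (le_max_left _ _) (by positivity)
  · calc ‖h.sbarVP hsmall hh0 x.2‖ ≤ sbarConst Ω c N C lam * (27 / 8) * ‖x.2‖ :=
          (ContinuousLinearMap.le_opNorm _ _).trans
            (mul_le_mul_of_nonneg_right (h.norm_sbarVP_le hsmall hh0) (norm_nonneg _))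
      _ ≤ max 1 (sbarConst Ω c N C lam * (27 / 8)) * max ‖x.1‖ ‖x.2‖ :=
          mul_le_mul (le_max_right _ _) (le_max_right _ _) (norm_nonneg _)
            (zero_le_one.trans (le_max_left _ _))

end Full

end CutoffQuadHyp


end CTWSAW

end Literature.Barriers.CriticalPhenomena
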